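import Summits.KontsevichZagierPeriods.KontsevichZagierPeriods.Theorems.TerasomaMultiplicationMultiplicationAccessibleStubMultiplicativityGlueAux2

/-!
# `MultiplicationAccessible` (stmt-KontsevichZagierPeriods-12305), line `shifted-family-prime-sieve`,
stub `stub_multiplicativityGlue` — helper API, part 3: block moves, re-association, absorption

Continuing the calculus of Beta boxes `[(0,1)^N, κ ∏ᵢ zᵢ^(αᵢ−1)(1−zᵢ)^(βᵢ−1)]` of parts 1–2:

* `blockwise` — on the box `(0,1)^(n₁ n₂)`, whose coordinates `k = j + n₂ i` are grouped into the
  `n₂` residue blocks `j = k mod n₂` (block coordinate `i = k div n₂`), an `n₁`-dimensional move may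
  be applied to every block (induction over the blocks with `local_move`);
* `reassoc_box` / `headMove` — the Dirichlet re-association `B(p,q)B(p+q,r) = B(q,r)B(p,q+r)`
  (a HYPOTHESIS throughout this file, discharged by the neighbouring stub `stub_betaReassoc`)
  as a move of 2-dimensional Beta boxes, and its "head" form
  `β(p, q+r) ⊗ β(q, r) ∼ β(p, q) ⊗ β(p+q, r)`;
* `absorption` — the caterpillar step `β(W, (a+1)s) ⊗ ⊗_{i=1}^{a} β(is, s) ∼ ⊗_{i=0}^{a} β(W+is, s)`
  by `a` head moves.
-/

noncomputable section

open MeasureTheory Set Real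
open scoped BigOperators

namespace Summit.KontsevichZagierPeriods.TerasomaMultiplication.MultiplicationAccessible.MultGlue

open Literature.NumberTheory.Transcendental
open Literature.NumberTheory.Transcendental.KZ
open Summit.KontsevichZagierPeriods.MultiplicationAccessible.Negative (boxDom)

/-! ## Index arithmetic on `Fin (n₁ * n₂)` -/

/-- The block coordinate of `finProdFinEquiv (i, j) = j + n₂ i` is `i`. [folklore] -/
theorem divNat_finProdFinEquiv {m n : ℕ} (i : Fin m) (j : Fin n) :
    (finProdFinEquiv (i, j)).divNat = i := by
  have h := finProdFinEquiv.symm_apply_apply (i, j)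
  rw [finProdFinEquiv_symm_apply, Prod.mk.injEq] at h
  exact h.1

/-- The block (residue) of `finProdFinEquiv (i, j) = j + n₂ i` is `j`. [folklore] -/
theorem modNat_finProdFinEquiv {m n : ℕ} (i : Fin m) (j : Fin n) :
    (finProdFinEquiv (i, j)).modNat = j := by
  have h := finProdFinEquiv.symm_apply_apply (i, j)
  rw [finProdFinEquiv_symm_apply, Prod.mk.injEq] at h
  exact h.2

/-- Every `k : Fin (m n)` is `finProdFinEquiv (k div n, k mod n)`. [folklore] -/
theorem finProdFinEquiv_divNat_modNat {m n : ℕ} (k : Fin (m * n)) :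
    finProdFinEquiv (k.divNat, k.modNat) = k := by
  have h := finProdFinEquiv.apply_symm_apply k
  rwa [finProdFinEquiv_symm_apply] at h

/-! ## Blockwise moves -/

/-- **Blockwise move.** On `(0,1)^(n₁ n₂)` group the coordinates `k = j + n₂ i` into the `n₂`
blocks `j = k mod n₂` with block coordinate `i = k div n₂`. If for every block `j` the
`n₁`-dimensional Beta boxes `[1, A j, B j] ∼ [c, A' j, B' j]` are equivalent, then
`[κ₀, A, B] ∼ [c^{n₂} κ₀, A', B']` for the assembled exponent vectors — induction over the blocks,
each step a `local_move` on the coordinates of one block. [cite: KontsevichZagier2001, §1.2] -/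
theorem blockwise {n₁ n₂ : ℕ} {c κ₀ : ℝ} (hc : IsAlgebraic ℚ c) (hκ₀ : IsAlgebraic ℚ κ₀)
    (A B A' B' : Fin n₂ → Fin n₁ → ℚ) (hA : ∀ j i, 0 < A j i) (hB : ∀ j i, 0 < B j i)
    (hA' : ∀ j i, 0 < A' j i) (hB' : ∀ j i, 0 < B' j i)
    (h : ∀ j, (∃ (ρ₁ : KZ.IntegralRep _) (ρ₂ : KZ.IntegralRep _),
        (ρ₁.domain = boxDom _ ∧ EqOn ρ₁.integrand
          (fun z : Fin _ → ℝ => (1:ℝ) *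
              ∏ i, (z i ^ (((A j i : ℚ) : ℝ) - 1) * (1 - z i) ^ (((B j i : ℚ) : ℝ) - 1)))
          ρ₁.domain) ∧
        (ρ₂.domain = boxDom _ ∧ EqOn ρ₂.integrand
          (fun z : Fin _ → ℝ => c *
              ∏ i, (z i ^ (((A' j i : ℚ) : ℝ) - 1) * (1 - z i) ^ (((B' j i : ℚ) : ℝ) - 1)))
          ρ₂.domain) ∧
        KZ.Equivalent ρ₁ ρ₂)) :
    (∃ (ρ₁ : KZ.IntegralRep _) (ρ₂ : KZ.IntegralRep _),
        (ρ₁.domain = boxDom _ ∧ EqOn ρ₁.integrand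
          (fun z : Fin _ → ℝ => κ₀ * ∏ i,
              (z i ^ ((((fun k : Fin (n₁ * n₂) => A k.modNat k.divNat) i : ℚ) : ℝ) - 1) *
                (1 - z i) ^ ((((fun k : Fin (n₁ * n₂) => B k.modNat k.divNat) i : ℚ) : ℝ) - 1)))
          ρ₁.domain) ∧
        (ρ₂.domain = boxDom _ ∧ EqOn ρ₂.integrand
          (fun z : Fin _ → ℝ => (c ^ n₂ * κ₀) * ∏ i,
              (z i ^ ((((fun k : Fin (n₁ * n₂) =>
                  A' k.modNat k.divNat) i : ℚ) : ℝ) - 1) *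
                (1 - z i) ^ ((((fun k : Fin (n₁ * n₂) =>
                    B' k.modNat k.divNat) i : ℚ) : ℝ) - 1)))
          ρ₂.domain) ∧
        KZ.Equivalent ρ₁ ρ₂) := by
  -- the state after the first `t` blocks have been moved
  have key : ∀ t, t ≤ n₂ →
      (∃ (ρ₁ : KZ.IntegralRep _) (ρ₂ : KZ.IntegralRep _),
          (ρ₁.domain = boxDom _ ∧ EqOn ρ₁.integrand
            (fun z : Fin _ → ℝ => κ₀ * ∏ i,
                (z i ^ ((((fun k : Fin (n₁ * n₂) => A k.modNat k.divNat) i : ℚ) : ℝ) - 1) *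
                  (1 - z i) ^ ((((fun k : Fin (n₁ * n₂) => B k.modNat k.divNat) i : ℚ) : ℝ) - 1)))
            ρ₁.domain) ∧
          (ρ₂.domain = boxDom _ ∧ EqOn ρ₂.integrand
            (fun z : Fin _ → ℝ => (c ^ t * κ₀) * ∏ i,
                (z i ^ ((((fun k : Fin (n₁ * n₂) =>
                    if (k.modNat : ℕ) < t then A' k.modNat k.divNat
                      else A k.modNat k.divNat) i : ℚ) : ℝ) - 1) *
                  (1 - z i) ^ ((((fun k : Fin (n₁ * n₂) =>
                      if (k.modNat : ℕ) < t then B' k.modNat k.divNat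
                        else B k.modNat k.divNat) i : ℚ) : ℝ) - 1)))
            ρ₂.domain) ∧
          KZ.Equivalent ρ₁ ρ₂) := by
    intro t
    induction t with
    | zero =>
      intro _
      exact beta_congr hκ₀ (by simp) (fun k => hA _ _) (fun k => hB _ _) (fun k => by simp)
        (fun k => by simp)
    | succ t ih =>
      intro ht
      have ht' : t < n₂ := ht
      refine equiv_trans (ih ht'.le) ?_
      have hι : Function.Injective
          (fun i : Fin n₁ => finProdFinEquiv (i, (⟨t, ht'⟩ : Fin n₂))) := by
        intro i i' hii'
        simpa using finProdFinEquiv.injective hii'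
      refine local_move (fun i : Fin n₁ => finProdFinEquiv (i, (⟨t, ht'⟩ : Fin n₂))) hι
        isAlgebraic_one hc ((hc.pow t).mul hκ₀) (by ring) (by ring)
        (α₁ := A ⟨t, ht'⟩) (β₁ := B ⟨t, ht'⟩) (α₁' := A' ⟨t, ht'⟩) (β₁' := B' ⟨t, ht'⟩)
        ?_ ?_ ?_ ?_ (h ⟨t, ht'⟩) ?_ ?_ ?_ ?_ ?_ ?_
      · intro k; split_ifs; exacts [hA' _ _, hA _ _]
      · intro k; split_ifs; exacts [hB' _ _, hB _ _]
      · intro k; split_ifs; exacts [hA' _ _, hA _ _]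
      · intro k; split_ifs; exacts [hB' _ _, hB _ _]
      · intro i; simp [modNat_finProdFinEquiv, divNat_finProdFinEquiv]
      · intro i; simp [modNat_finProdFinEquiv, divNat_finProdFinEquiv]
      · intro i; simp [modNat_finProdFinEquiv, divNat_finProdFinEquiv]
      · intro i; simp [modNat_finProdFinEquiv, divNat_finProdFinEquiv]
      · intro k hk
        have hne : (k.modNat : ℕ) ≠ t := fun heq => hk ⟨k.divNat, by
          dsimp only
          rw [show (⟨t, ht'⟩ : Fin n₂) = k.modNat from Fin.ext heq.symm]
          exact finProdFinEquiv_divNat_modNat k⟩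
        split_ifs with h₁ h₂ h₂ <;> first | rfl | omega
      · intro k hk
        have hne : (k.modNat : ℕ) ≠ t := fun heq => hk ⟨k.divNat, by
          dsimp only
          rw [show (⟨t, ht'⟩ : Fin n₂) = k.modNat from Fin.ext heq.symm]
          exact finProdFinEquiv_divNat_modNat k⟩
        split_ifs with h₁ h₂ h₂ <;> first | rfl | omega
  refine equiv_trans (key n₂ le_rfl) (beta_congr ((hc.pow n₂).mul hκ₀) rfl ?_ ?_ ?_ ?_)
  · intro k; split_ifs; exacts [hA' _ _, hA _ _]
  · intro k; split_ifs; exacts [hB' _ _, hB _ _]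
  · intro k; exact if_pos k.modNat.isLt
  · intro k; exact if_pos k.modNat.isLt

/-! ## The re-association move and the head move -/

/-- Entries of a pair `![u, v]` of positive rationals are positive. [folklore] -/
theorem vec2_pos {u v : ℚ} (hu : 0 < u) (hv : 0 < v) : ∀ i : Fin 2, 0 < ![u, v] i :=
  Fin.forall_fin_two.mpr ⟨by simpa using hu, by simpa using hv⟩

/-- **Re-association as a move of Beta boxes** (from the hypothesis `BetaReassoc`, the statement
of the neighbouring stub `stub_betaReassoc`): `[1, (p, p+q), (q, r)] ∼ [1, (q, p), (r, q+r)]`,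
i.e. `β(p,q) ⊗ β(p+q,r) ∼ β(q,r) ⊗ β(p,q+r)` (Andrews–Askey–Roy 1999, Thm 1.8.1). [folklore] -/
theorem reassoc_box
    (hBR : ∀ (a b c : ℚ), 0 < a → 0 < b → 0 < c → ∀ (r r' : KZ.IntegralRep 2),
      r.domain = {z | ∀ i, z i ∈ Set.Ioo (0:ℝ) 1} →
      Set.EqOn r.integrand (fun z => (z 0) ^ ((a:ℝ) - 1) * (1 - z 0) ^ ((b:ℝ) - 1) *
        ((z 1) ^ ((a:ℝ) + (b:ℝ) - 1) * (1 - z 1) ^ ((c:ℝ) - 1))) r.domain →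
      r'.domain = {z | ∀ i, z i ∈ Set.Ioo (0:ℝ) 1} →
      Set.EqOn r'.integrand (fun z => (z 0) ^ ((b:ℝ) - 1) * (1 - z 0) ^ ((c:ℝ) - 1) *
        ((z 1) ^ ((a:ℝ) - 1) * (1 - z 1) ^ ((b:ℝ) + (c:ℝ) - 1))) r'.domain →
      KZ.Equivalent r r')
    {p q r : ℚ} (hp : 0 < p) (hq : 0 < q) (hr : 0 < r) :
    (∃ (ρ₁ : KZ.IntegralRep _) (ρ₂ : KZ.IntegralRep _),
        (ρ₁.domain = boxDom _ ∧ EqOn ρ₁.integrand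
          (fun z : Fin _ → ℝ => (1:ℝ) * ∏ i,
              (z i ^ (((![p, p + q] i : ℚ) : ℝ) - 1) *
                (1 - z i) ^ (((![q, r] i : ℚ) : ℝ) - 1)))
          ρ₁.domain) ∧
        (ρ₂.domain = boxDom _ ∧ EqOn ρ₂.integrand
          (fun z : Fin _ → ℝ => (1:ℝ) * ∏ i,
              (z i ^ (((![q, p] i : ℚ) : ℝ) - 1) *
                (1 - z i) ^ (((![r, q + r] i : ℚ) : ℝ) - 1)))
          ρ₂.domain) ∧
        KZ.Equivalent ρ₁ ρ₂) := by
  obtain ⟨ρ, hρd, hρi⟩ := exists_betaRep (1:ℝ) isAlgebraic_one ![p, p + q] ![q, r]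
    (vec2_pos hp (by positivity)) (vec2_pos hq hr)
  obtain ⟨ρ', hρ'd, hρ'i⟩ := exists_betaRep (1:ℝ) isAlgebraic_one ![q, p] ![r, q + r]
    (vec2_pos hq hp) (vec2_pos hr (by positivity))
  refine ⟨ρ, ρ', ⟨hρd, hρi⟩, ⟨hρ'd, hρ'i⟩,
    hBR p q r hp hq hr ρ ρ' hρd (fun z hz => ?_) hρ'd (fun z hz => ?_)⟩
  · rw [hρi hz]
    simp [Fin.prod_univ_two]
  · rw [hρ'i hz]
    simp [Fin.prod_univ_two]

/-- **The head move**: `[1, (p, q), (q+r, r)] ∼ [1, (p, p+q), (q, r)]`, i.e.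
`β(p, q+r) ⊗ β(q, r) ∼ β(p, q) ⊗ β(p+q, r)` — swap the two coordinates, then re-associate
backwards. [folklore] -/
theorem headMove
    (hBR : ∀ (a b c : ℚ), 0 < a → 0 < b → 0 < c → ∀ (r r' : KZ.IntegralRep 2),
      r.domain = {z | ∀ i, z i ∈ Set.Ioo (0:ℝ) 1} →
      Set.EqOn r.integrand (fun z => (z 0) ^ ((a:ℝ) - 1) * (1 - z 0) ^ ((b:ℝ) - 1) *
        ((z 1) ^ ((a:ℝ) + (b:ℝ) - 1) * (1 - z 1) ^ ((c:ℝ) - 1))) r.domain →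
      r'.domain = {z | ∀ i, z i ∈ Set.Ioo (0:ℝ) 1} →
      Set.EqOn r'.integrand (fun z => (z 0) ^ ((b:ℝ) - 1) * (1 - z 0) ^ ((c:ℝ) - 1) *
        ((z 1) ^ ((a:ℝ) - 1) * (1 - z 1) ^ ((b:ℝ) + (c:ℝ) - 1))) r'.domain →
      KZ.Equivalent r r')
    {p q r : ℚ} (hp : 0 < p) (hq : 0 < q) (hr : 0 < r) :
    (∃ (ρ₁ : KZ.IntegralRep _) (ρ₂ : KZ.IntegralRep _),
        (ρ₁.domain = boxDom _ ∧ EqOn ρ₁.integrand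
          (fun z : Fin _ → ℝ => (1:ℝ) * ∏ i,
              (z i ^ (((![p, q] i : ℚ) : ℝ) - 1) *
                (1 - z i) ^ (((![q + r, r] i : ℚ) : ℝ) - 1)))
          ρ₁.domain) ∧
        (ρ₂.domain = boxDom _ ∧ EqOn ρ₂.integrand
          (fun z : Fin _ → ℝ => (1:ℝ) * ∏ i,
              (z i ^ (((![p, p + q] i : ℚ) : ℝ) - 1) *
                (1 - z i) ^ (((![q, r] i : ℚ) : ℝ) - 1)))
          ρ₂.domain) ∧
        KZ.Equivalent ρ₁ ρ₂) := by
  have hswap : (∃ (ρ₁ : KZ.IntegralRep _) (ρ₂ : KZ.IntegralRep _),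
      (ρ₁.domain = boxDom _ ∧ EqOn ρ₁.integrand
        (fun z : Fin _ → ℝ => (1:ℝ) *
            ∏ i, (z i ^ (((![p, q] i : ℚ) : ℝ) - 1) * (1 - z i) ^ (((![q + r, r] i : ℚ) : ℝ) - 1)))
        ρ₁.domain) ∧
      (ρ₂.domain = boxDom _ ∧ EqOn ρ₂.integrand
        (fun z : Fin _ → ℝ => (1:ℝ) *
            ∏ i, (z i ^ (((![q, p] i : ℚ) : ℝ) - 1) * (1 - z i) ^ (((![r, q + r] i : ℚ) : ℝ) - 1)))
        ρ₂.domain) ∧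
      KZ.Equivalent ρ₁ ρ₂) :=
    beta_perm (Equiv.swap (0 : Fin 2) 1) isAlgebraic_one (vec2_pos hp hq)
      (vec2_pos (by positivity) hr)
      (Fin.forall_fin_two.mpr ⟨by simp, by simp⟩) (Fin.forall_fin_two.mpr ⟨by simp, by simp⟩)
  exact equiv_trans hswap (equiv_symm (reassoc_box hBR hp hq hr))

/-! ## Absorption (the caterpillar step) -/

/-- **Absorption**: `β(W, (a+1)s) ⊗ β(s,s) ⊗ β(2s,s) ⊗ ⋯ ⊗ β(as,s) ∼ ⊗_{i=0}^{a} β(W + is, s)` as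
`(a+1)`-dimensional Beta boxes (head at coordinate `0`, the factor `β(is, s)` at coordinate `i`):
`a` head moves, the `(d+1)`-st acting on the coordinates `0` and `a - d` and turning the pair
`β(W, (a+1-d)s), β((a-d)s, s)` into `β(W, (a-d)s), β(W + (a-d)s, s)`. [folklore] -/
theorem absorption
    (hBR : ∀ (a b c : ℚ), 0 < a → 0 < b → 0 < c → ∀ (r r' : KZ.IntegralRep 2),
      r.domain = {z | ∀ i, z i ∈ Set.Ioo (0:ℝ) 1} →
      Set.EqOn r.integrand (fun z => (z 0) ^ ((a:ℝ) - 1) * (1 - z 0) ^ ((b:ℝ) - 1) *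
        ((z 1) ^ ((a:ℝ) + (b:ℝ) - 1) * (1 - z 1) ^ ((c:ℝ) - 1))) r.domain →
      r'.domain = {z | ∀ i, z i ∈ Set.Ioo (0:ℝ) 1} →
      Set.EqOn r'.integrand (fun z => (z 0) ^ ((b:ℝ) - 1) * (1 - z 0) ^ ((c:ℝ) - 1) *
        ((z 1) ^ ((a:ℝ) - 1) * (1 - z 1) ^ ((b:ℝ) + (c:ℝ) - 1))) r'.domain →
      KZ.Equivalent r r')
    (a : ℕ) {W s : ℚ} (hW : 0 < W) (hs : 0 < s) :
    (∃ (ρ₁ : KZ.IntegralRep _) (ρ₂ : KZ.IntegralRep _),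
        (ρ₁.domain = boxDom _ ∧ EqOn ρ₁.integrand
          (fun z : Fin _ → ℝ => (1:ℝ) * ∏ i,
              (z i ^ ((((fun i : Fin (a + 1) =>
                  if (i : ℕ) = 0 then W else (i : ℚ) * s) i : ℚ) : ℝ) - 1) *
                (1 - z i) ^ ((((fun i : Fin (a + 1) =>
                    if (i : ℕ) = 0 then ((a : ℚ) + 1) * s else s) i : ℚ) : ℝ) - 1)))
          ρ₁.domain) ∧
        (ρ₂.domain = boxDom _ ∧ EqOn ρ₂.integrand
          (fun z : Fin _ → ℝ => (1:ℝ) * ∏ i,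
              (z i ^ ((((fun i : Fin (a + 1) => W + (i : ℚ) * s) i : ℚ) : ℝ) - 1) *
                (1 - z i) ^ ((((fun _ : Fin (a + 1) => s) i : ℚ) : ℝ) - 1)))
          ρ₂.domain) ∧
        KZ.Equivalent ρ₁ ρ₂) := by
  have hks : ∀ i : Fin (a + 1), (i : ℕ) ≠ 0 → (0 : ℚ) < (i : ℚ) * s := fun i hi =>
    mul_pos (Nat.cast_pos.mpr (Nat.pos_of_ne_zero hi)) hs
  -- the state after `d` head moves
  have key : ∀ d, d ≤ a →
      (∃ (ρ₁ : KZ.IntegralRep _) (ρ₂ : KZ.IntegralRep _),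
          (ρ₁.domain = boxDom _ ∧ EqOn ρ₁.integrand
            (fun z : Fin _ → ℝ => (1:ℝ) * ∏ i,
                (z i ^ ((((fun i : Fin (a + 1) =>
                    if (i : ℕ) = 0 then W else (i : ℚ) * s) i : ℚ) : ℝ) - 1) *
                  (1 - z i) ^ ((((fun i : Fin (a + 1) =>
                      if (i : ℕ) = 0 then ((a : ℚ) + 1) * s else s) i : ℚ) : ℝ) - 1)))
            ρ₁.domain) ∧
          (ρ₂.domain = boxDom _ ∧ EqOn ρ₂.integrand
            (fun z : Fin _ → ℝ => (1:ℝ) * ∏ i,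
                (z i ^ ((((fun i : Fin (a + 1) =>
                    if (i : ℕ) = 0 then W else
                      if a < (i : ℕ) + d then W + (i : ℚ) * s else (i : ℚ) * s) i : ℚ) : ℝ) - 1) *
                  (1 - z i) ^ ((((fun i : Fin (a + 1) =>
                      if (i : ℕ) = 0 then ((a : ℚ) + 1 - d) * s else s) i : ℚ) : ℝ) - 1)))
            ρ₂.domain) ∧
          KZ.Equivalent ρ₁ ρ₂) := by
    intro d
    induction d with
    | zero =>
      intro _
      refine beta_congr isAlgebraic_one rfl ?_ ?_ ?_ ?_
      · intro i; split_ifs with h; exacts [hW, hks i h]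
      · intro i; split_ifs; exacts [by positivity, hs]
      · intro i
        split_ifs with h₁ h₂
        · rfl
        · exfalso; have := i.isLt; omega
        · rfl
      · intro i; simp
    | succ d ih =>
      intro hd
      have hd' : d < a := hd
      refine equiv_trans (ih hd'.le) ?_
      have hdq : (d : ℚ) < a := by exact_mod_cast hd'
      have hpos : (0:ℚ) < ((a : ℚ) - d) * s := mul_pos (by linarith) hs
      have hcast : ((a - d : ℕ) : ℚ) = (a : ℚ) - d := Nat.cast_sub hd'.le
      have hι : Function.Injective
          (![(0 : Fin (a + 1)), ⟨a - d, by omega⟩] : Fin 2 → Fin (a + 1)) := by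
        intro i j hij
        fin_cases i <;> fin_cases j
        · rfl
        · exfalso; simp [Fin.ext_iff] at hij; omega
        · exfalso; simp [Fin.ext_iff] at hij; omega
        · rfl
      refine local_move (![(0 : Fin (a + 1)), ⟨a - d, by omega⟩] : Fin 2 → Fin (a + 1)) hι
        isAlgebraic_one isAlgebraic_one isAlgebraic_one (one_mul _).symm (one_mul _).symm
        (α₁ := ![W, ((a : ℚ) - d) * s]) (β₁ := ![((a : ℚ) - d) * s + s, s])
        (α₁' := ![W, W + ((a : ℚ) - d) * s]) (β₁' := ![((a : ℚ) - d) * s, s])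
        ?_ ?_ ?_ ?_ (headMove hBR hW hpos hs) ?_ ?_ ?_ ?_ ?_ ?_
      · intro i
        split_ifs with h₁ h₂; exacts [hW, add_pos hW (hks i h₁), hks i h₁]
      · intro i
        split_ifs
        · have : (d : ℚ) ≤ a := hdq.le
          exact mul_pos (by linarith) hs
        · exact hs
      · intro i
        split_ifs with h₁ h₂; exacts [hW, add_pos hW (hks i h₁), hks i h₁]
      · intro i
        split_ifs
        · have : ((d + 1 : ℕ) : ℚ) ≤ a := by exact_mod_cast hd
          exact mul_pos (by linarith) hs
        · exact hs
      · refine Fin.forall_fin_two.mpr ⟨by simp, ?_⟩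
        simp only [Matrix.cons_val_one, Matrix.cons_val_zero]
        rw [if_neg (by omega), if_neg (by omega), hcast]
      · refine Fin.forall_fin_two.mpr ⟨by simp; ring, ?_⟩
        simp only [Matrix.cons_val_one, Matrix.cons_val_zero]
        rw [if_neg (by omega)]
      · refine Fin.forall_fin_two.mpr ⟨by simp, ?_⟩
        simp only [Matrix.cons_val_one, Matrix.cons_val_zero]
        rw [if_neg (by omega), if_pos (by omega), hcast]
      · refine Fin.forall_fin_two.mpr ⟨by simp, ?_⟩
        simp only [Matrix.cons_val_one, Matrix.cons_val_zero]
        rw [if_neg (by omega)]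
      · intro k hk
        have hk1 : (k : ℕ) ≠ a - d := fun h => hk ⟨1, Fin.ext (by simp [h])⟩
        split_ifs with h₁ h₂ h₃ h₃ <;> first | rfl | (exfalso; omega)
      · intro k hk
        have hk0 : (k : ℕ) ≠ 0 := fun h => hk ⟨0, Fin.ext (by simp [h])⟩
        rw [if_neg hk0, if_neg hk0]
  refine equiv_trans (key a le_rfl) (beta_congr isAlgebraic_one rfl ?_ ?_ ?_ ?_)
  · intro i
    split_ifs with h₁ h₂; exacts [hW, add_pos hW (hks i h₁), hks i h₁]
  · intro i
    split_ifs
    · exact mul_pos (by linarith) hs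
    · exact hs
  · intro i
    split_ifs with h₁ h₂
    · simp [h₁]
    · rfl
    · exfalso; omega
  · intro i
    split_ifs
    · ring
    · rfl

end Summit.KontsevichZagierPeriods.TerasomaMultiplication.MultiplicationAccessible.MultGlue

namespace Summit.KontsevichZagierPeriods.TerasomaMultiplication.MultiplicationAccessible

open Literature.NumberTheory.Transcendental

/-- **Registered sub-goal `stub_multiplicativityGlue_part3` of stub `stub_multiplicativityGlue`**
(`∀`-form of `MultGlue.absorption`, the caterpillar step): given the Dirichlet re-association
move, `β(W, (a+1)s) ⊗ β(s,s) ⊗ ⋯ ⊗ β(as,s) ∼ ⊗_{i=0}^{a} β(W + is, s)` as `(a+1)`-dimensional Beta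
boxes. [folklore] -/
theorem stub_multiplicativityGlue_part3 :
    (∀ (a b c : ℚ), 0 < a → 0 < b → 0 < c → ∀ (r r' : KZ.IntegralRep 2),
      r.domain = {z | ∀ i, z i ∈ Set.Ioo (0:ℝ) 1} →
      Set.EqOn r.integrand (fun z => (z 0) ^ ((a:ℝ) - 1) * (1 - z 0) ^ ((b:ℝ) - 1) *
        ((z 1) ^ ((a:ℝ) + (b:ℝ) - 1) * (1 - z 1) ^ ((c:ℝ) - 1))) r.domain →
      r'.domain = {z | ∀ i, z i ∈ Set.Ioo (0:ℝ) 1} →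
      Set.EqOn r'.integrand (fun z => (z 0) ^ ((b:ℝ) - 1) * (1 - z 0) ^ ((c:ℝ) - 1) *
        ((z 1) ^ ((a:ℝ) - 1) * (1 - z 1) ^ ((b:ℝ) + (c:ℝ) - 1))) r'.domain →
      KZ.Equivalent r r') →
    ∀ (a : ℕ) (W s : ℚ), 0 < W → 0 < s →
      ∃ (ρ₁ : KZ.IntegralRep (a + 1)) (ρ₂ : KZ.IntegralRep (a + 1)),
        (ρ₁.domain = {z | ∀ i, z i ∈ Set.Ioo (0:ℝ) 1} ∧ Set.EqOn ρ₁.integrand (fun z => (1:ℝ) * ∏ i,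
          ((z i) ^ ((((if (i : ℕ) = 0 then W else (i : ℚ) * s : ℚ)) : ℝ) - 1) *
            (1 - z i) ^ ((((if (i : ℕ) = 0 then ((a : ℚ) + 1) * s else s : ℚ)) : ℝ) - 1)))
          ρ₁.domain) ∧
        (ρ₂.domain = {z | ∀ i, z i ∈ Set.Ioo (0:ℝ) 1} ∧ Set.EqOn ρ₂.integrand (fun z => (1:ℝ) * ∏ i,
          ((z i) ^ (((W + (i : ℚ) * s : ℚ) : ℝ) - 1) * (1 - z i) ^ (((s : ℚ) : ℝ) - 1))) ρ₂.domain) ∧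
        KZ.Equivalent ρ₁ ρ₂ :=
  fun hBR a _ _ hW hs => MultGlue.absorption hBR a hW hs

end Summit.KontsevichZagierPeriods.TerasomaMultiplication.MultiplicationAccessible

end
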